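import Literature.NumberTheory.Transcendental.RoySmallValueDecomposition
import Literature.NumberTheory.Transcendental.NesterenkoCoeffNorms
import Mathlib.LinearAlgebra.Matrix.Determinant.Basic
import Mathlib.LinearAlgebra.Matrix.Reindex
import Mathlib.Analysis.Normed.Ring.Int
import HarnessLib

/-!
# Roy's small value estimate for `𝔾ₐ × 𝔾ₘ` — the determinant `Φ` of Theorem 5.2 (`m = 2`): definition and size

Topic `Literature/NumberTheory/Transcendental`. Part of the formalisation of the proof of Roy 2013,
Theorem 1.1 (named fact `roy2013_thm_1_1`, `RoySmallValueEstimates.lean`). Source: D. Roy,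
*A small value estimate for `𝔾ₐ × 𝔾ₘ`*, Mathematika 59 (2013) 333–363 = arXiv:1301.0663, §5,
proof of Theorem 5.2 (pp. 13–14 of the arXiv text):

> "For each `(m+1)`-tuple `Q = (Q₀, …, Q_m) ∈ ℂ[X]_D^{m+1}`, we define a linear map
> `φ_Q : E₀ × ⋯ × E_m → ℂ[X]_ν`, `(A₀, …, A_m) ↦ A₀Q₀ + ⋯ + A_mQ_m` … we denote by `M_Q` the
> matrix of `φ_Q` with respect to the bases `𝒜` and `𝓑` … Then the map `Φ : Q ↦ det(M_Q)` is a
> multihomogeneous polynomial map …"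

Here `m = 2`, `ν = 3D`, `E₀ = ℂ[X]_{2D}` and `E₁, E₂` spanned by sets `M₁, M₂` of monomials of
degree `2D` (Lemma 5.1, `RoySmallValueDecomposition.lean`, `exists_monomial_complement`); the bases
are monomial bases, so the entries of `M_Q` are coefficients of the `Qᵢ`:

* `royMatrix D M₁ M₂ Qs` — the matrix `M_Q` (rows: exponents of degree `3D`; columns: exponents
  of degree `2D`, then `M₁`, then `M₂`; entry `[X^e](X^μ Qᵢ)`), additive and homogeneous in `Q`;
* `royPhi D M₁ M₂ σ Qs = det M_Q` after identifying columns with rows through a bijection `σ`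
  (which exists when the cardinalities agree, i.e. under the dimension count of Lemma 5.1; the
  choice of `σ` only affects the sign);
* `combo Qs a = ∑ a_c X^{μ_c} Q_{i_c}` — the polynomial `φ_Q(A)` with coordinate vector `a`, and
  `coeff_combo` — its coefficients are `M_Q · a`;
* `norm_royPhi_le` — `|Φ(Q)| ≤ N! · (max ‖Qᵢ‖)^N`, `N = binom(3D+2, 2)` (used in place of the
  height of the resultant, Lemma 2.1, in Proposition 6.1).

In this development `Φ` replaces the resultant `Res_D` throughout §§5–6: the printed proof of
Theorem 5.2 establishes the multiplicity property for `Φ` first and transfers it to `Res_D` by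
divisibility; Propositions 6.1 and 6.4 only use that property (see the sequel). Definitions:
`colExp`, `colBlock`, `royMatrix`, `royPhi`, `combo`. Everything is proved; no new named facts.

## References

* [Roy2013] D. Roy, *A small value estimate for 𝔾ₐ × 𝔾ₘ*, Mathematika 59 (2013), 333–363
  (arXiv:1301.0663), §5, proof of Theorem 5.2.
-/

noncomputable section

open MvPolynomial Finset Module Matrix

namespace Literature.NumberTheory.Transcendental

namespace Roy2013

open Nesterenko

variable {D : ℕ} {M₁ M₂ : Finset (Fin 3 →₀ ℕ)}

/-! ### Indices -/

/-- The exponent of the monomial labelling a column. [cite: Roy2013, §5, proof of Theorem 5.2] -/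
def colExp : ↥(finsuppAntidiag (univ : Finset (Fin 3)) (2 * D)) ⊕ (↥M₁ ⊕ ↥M₂) → (Fin 3 →₀ ℕ) :=
  Sum.elim (fun μ => μ.1) (Sum.elim (fun μ => μ.1) (fun μ => μ.1))

/-- The block (`0, 1, 2`) of a column. [cite: Roy2013, §5, proof of Theorem 5.2] -/
def colBlock : ↥(finsuppAntidiag (univ : Finset (Fin 3)) (2 * D)) ⊕ (↥M₁ ⊕ ↥M₂) → Fin 3 :=
  Sum.elim (fun _ => 0) (Sum.elim (fun _ => 1) (fun _ => 2))

/-! ### The matrix `M_Q` and the determinant `Φ` -/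

/-- **The matrix `M_Q`** of `(A₀, A₁, A₂) ↦ A₀Q₀ + A₁Q₁ + A₂Q₂` in monomial bases: the entry in
row `e` (`|e| = 3D`) and column `(i, μ)` is the coefficient of `X^e` in `X^μ Qᵢ`.
[cite: Roy2013, §5, proof of Theorem 5.2] -/
def royMatrix (D : ℕ) (M₁ M₂ : Finset (Fin 3 →₀ ℕ)) (Qs : Fin 3 → CX) :
    Matrix ↥(finsuppAntidiag (univ : Finset (Fin 3)) (3 * D))
      (↥(finsuppAntidiag (univ : Finset (Fin 3)) (2 * D)) ⊕ (↥M₁ ⊕ ↥M₂)) ℂ :=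
  Matrix.of fun e c => coeff e.1 (monomial (colExp c) (1 : ℂ) * Qs (colBlock c))

/-- Entries of `M_Q`. [cite: Roy2013, §5, proof of Theorem 5.2] -/
theorem royMatrix_apply (Qs : Fin 3 → CX) (e : ↥(finsuppAntidiag (univ : Finset (Fin 3)) (3 * D)))
    (c : ↥(finsuppAntidiag (univ : Finset (Fin 3)) (2 * D)) ⊕ (↥M₁ ⊕ ↥M₂)) :
    royMatrix D M₁ M₂ Qs e c = coeff e.1 (monomial (colExp c) (1 : ℂ) * Qs (colBlock c)) := rfl

/-- `M_Q` is additive in `Q`. [cite: Roy2013, §5, proof of Theorem 5.2] -/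
theorem royMatrix_add (Qs Rs : Fin 3 → CX) :
    royMatrix D M₁ M₂ (Qs + Rs) = royMatrix D M₁ M₂ Qs + royMatrix D M₁ M₂ Rs := by
  ext e c
  simp only [royMatrix_apply, Matrix.add_apply, Pi.add_apply, mul_add, coeff_add]

/-- `M_Q` is homogeneous of degree `1` in `Q`. [cite: Roy2013, §5, proof of Theorem 5.2] -/
theorem royMatrix_smul (t : ℂ) (Qs : Fin 3 → CX) :
    royMatrix D M₁ M₂ (t • Qs) = t • royMatrix D M₁ M₂ Qs := by
  ext e c
  simp only [royMatrix_apply, Matrix.smul_apply, Pi.smul_apply, mul_smul_comm, coeff_smul]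

/-- **`Φ(Q) = det M_Q`**, the columns being identified with the rows through the bijection `σ`.
[cite: Roy2013, §5, proof of Theorem 5.2] -/
def royPhi (D : ℕ) (M₁ M₂ : Finset (Fin 3 →₀ ℕ))
    (σ : (↥(finsuppAntidiag (univ : Finset (Fin 3)) (2 * D)) ⊕ (↥M₁ ⊕ ↥M₂)) ≃
      ↥(finsuppAntidiag (univ : Finset (Fin 3)) (3 * D))) (Qs : Fin 3 → CX) : ℂ :=
  ((royMatrix D M₁ M₂ Qs).reindex (Equiv.refl _) σ).det

/-! ### The polynomial with a given coordinate vector -/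

/-- `φ_Q(A) = ∑_c a_c · X^{μ_c} Q_{i_c}` for the coordinate vector `a` of `A = (A₀, A₁, A₂)`.
[cite: Roy2013, §5, proof of Theorem 5.2] -/
def combo (Qs : Fin 3 → CX)
    (a : ↥(finsuppAntidiag (univ : Finset (Fin 3)) (2 * D)) ⊕ (↥M₁ ⊕ ↥M₂) → ℂ) : CX :=
  ∑ c, a c • (monomial (colExp c) (1 : ℂ) * Qs (colBlock c))

/-- **The coefficients of `φ_Q(A)` are `M_Q · a`.** [cite: Roy2013, §5, proof of Theorem 5.2] -/
theorem coeff_combo (Qs : Fin 3 → CX)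
    (a : ↥(finsuppAntidiag (univ : Finset (Fin 3)) (2 * D)) ⊕ (↥M₁ ⊕ ↥M₂) → ℂ)
    (e : ↥(finsuppAntidiag (univ : Finset (Fin 3)) (3 * D))) :
    coeff e.1 (combo Qs a) = (royMatrix D M₁ M₂ Qs).mulVec a e := by
  rw [combo, Matrix.mulVec, dotProduct]
  simp only [coeff_sum, coeff_smul, smul_eq_mul, royMatrix_apply, mul_comm (a _)]

/-- `φ_Q(A) ∈ ℂ[X]_{3D}` when the `Qᵢ` are forms of degree `D` and the column monomials have
degree `2D`. [cite: Roy2013, §5, proof of Theorem 5.2] -/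
theorem isHomogeneous_combo {Qs : Fin 3 → CX} (hQ : ∀ i, (Qs i).IsHomogeneous D)
    (hM₁ : ∀ μ ∈ M₁, μ.degree = 2 * D) (hM₂ : ∀ μ ∈ M₂, μ.degree = 2 * D)
    (a : ↥(finsuppAntidiag (univ : Finset (Fin 3)) (2 * D)) ⊕ (↥M₁ ⊕ ↥M₂) → ℂ) :
    (combo Qs a).IsHomogeneous (3 * D) := by
  refine IsHomogeneous.sum _ _ _ fun c _ => ?_
  have hdeg : (colExp c).degree = 2 * D := by
    rcases c with μ | μ | μ
    · have h := μ.2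
      rw [mem_finsuppAntidiag] at h
      change (μ.1).degree = 2 * D
      rw [Finsupp.degree_eq_sum]; exact h.1
    · exact hM₁ _ μ.2
    · exact hM₂ _ μ.2
  have h := (isHomogeneous_monomial (R := ℂ) (1 : ℂ) hdeg).mul (hQ (colBlock c))
  rw [show 2 * D + D = 3 * D by ring] at h
  exact (homogeneousSubmodule (Fin 3) ℂ (3 * D)).smul_mem (a c) h

/-- A form of degree `3D` vanishes iff its coefficients on the degree-`3D` monomials vanish.
[folklore] -/
theorem eq_zero_of_coeff_row_eq_zero {F : CX} (hF : F.IsHomogeneous (3 * D))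
    (h : ∀ e : ↥(finsuppAntidiag (univ : Finset (Fin 3)) (3 * D)), coeff e.1 F = 0) : F = 0 := by
  ext ν
  rw [coeff_zero]
  by_cases hν : coeff ν F = 0
  · exact hν
  · have hdeg : ν ∈ finsuppAntidiag (univ : Finset (Fin 3)) (3 * D) := by
      rw [mem_finsuppAntidiag]
      refine ⟨?_, by simp⟩
      have h1 : ν.degree = 3 * D := by rw [Finsupp.degree_eq_weight_one]; exact hF hν
      rwa [Finsupp.degree_eq_sum] at h1
    exact absurd (h ⟨ν, hdeg⟩) hν

/-! ### The size of `Φ` -/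

/-- Entries of `M_Q` are coefficients of the `Qᵢ`: `|[X^e](X^μ Qᵢ)| ≤ ‖Qᵢ‖`.
[cite: Roy2013, §5, proof of Theorem 5.2] -/
theorem norm_royMatrix_le (Qs : Fin 3 → CX) {B : ℝ} (hB : ∀ i, maxNorm (Qs i) ≤ B)
    (e : ↥(finsuppAntidiag (univ : Finset (Fin 3)) (3 * D)))
    (c : ↥(finsuppAntidiag (univ : Finset (Fin 3)) (2 * D)) ⊕ (↥M₁ ⊕ ↥M₂)) :
    ‖royMatrix D M₁ M₂ Qs e c‖ ≤ B := by
  classical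
  rw [royMatrix_apply, coeff_monomial_mul']
  split_ifs
  · rw [one_mul]; exact (norm_coeff_le_maxNorm _ _).trans (hB _)
  · rw [norm_zero]; exact (maxNorm_nonneg _).trans (hB 0)

/-- **`|Φ(Q)| ≤ N! (max ‖Qᵢ‖)^N`**, `N = binom(3D+2, 2)` the number of monomials of degree `3D`.
[cite: Roy2013, §5, proof of Theorem 5.2] -/
theorem norm_royPhi_le
    (σ : (↥(finsuppAntidiag (univ : Finset (Fin 3)) (2 * D)) ⊕ (↥M₁ ⊕ ↥M₂)) ≃
      ↥(finsuppAntidiag (univ : Finset (Fin 3)) (3 * D)))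
    (Qs : Fin 3 → CX) {B : ℝ} (hB : ∀ i, maxNorm (Qs i) ≤ B) :
    ‖royPhi D M₁ M₂ σ Qs‖ ≤
      (Fintype.card ↥(finsuppAntidiag (univ : Finset (Fin 3)) (3 * D))).factorial *
        B ^ Fintype.card ↥(finsuppAntidiag (univ : Finset (Fin 3)) (3 * D)) := by
  have hB0 : 0 ≤ B := (maxNorm_nonneg _).trans (hB 0)
  rw [royPhi, Matrix.det_apply]
  refine (norm_sum_le _ _).trans ?_
  calc ∑ τ : Equiv.Perm _, ‖Equiv.Perm.sign τ •
          ∏ i, ((royMatrix D M₁ M₂ Qs).reindex (Equiv.refl _) σ) (τ i) i‖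
      ≤ ∑ _τ : Equiv.Perm ↥(finsuppAntidiag (univ : Finset (Fin 3)) (3 * D)),
          B ^ Fintype.card ↥(finsuppAntidiag (univ : Finset (Fin 3)) (3 * D)) := by
        refine Finset.sum_le_sum fun τ _ => ?_
        rw [Units.smul_def, norm_smul, Int.norm_coe_units, one_mul, norm_prod]
        calc ∏ i, ‖((royMatrix D M₁ M₂ Qs).reindex (Equiv.refl _) σ) (τ i) i‖
            ≤ ∏ _i : ↥(finsuppAntidiag (univ : Finset (Fin 3)) (3 * D)), B :=
              Finset.prod_le_prod (fun _ _ => norm_nonneg _) fun i _ => by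
                rw [Matrix.reindex_apply, Matrix.submatrix_apply]
                exact norm_royMatrix_le Qs hB _ _
          _ = B ^ Fintype.card _ := by simp
    _ = (Fintype.card ↥(finsuppAntidiag (univ : Finset (Fin 3)) (3 * D))).factorial *
          B ^ Fintype.card ↥(finsuppAntidiag (univ : Finset (Fin 3)) (3 * D)) := by
        rw [Finset.sum_const, nsmul_eq_mul, Finset.card_univ, Fintype.card_perm]

end Roy2013

end Literature.NumberTheory.Transcendental
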